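import Literature.NumberTheory.LFunctions.ExplicitFormulaPsiChar
import HarnessLib

/-!
# The sum `∑ x^{Re ρ}` over the zeros of a real `L`-function in the Linnik range
# (Granville–Mollin 2000, (3.2), after Bombieri, *Le grand crible*, Théorème 14): named fact

Topic `Literature/NumberTheory/LFunctions`. ONE named fact (D-0014), the input "(3.2)" of
Granville–Mollin's explicit formula in the Linnik range
(`Literature.NumberTheory.LFunctions.SiegelZero.GranvilleMollin2000_eq33`,
`ExceptionalZeroPrimeSums.lean`; the other input, "(3.1)", is Montgomery–Vaughan's Theorem 12.10,
`Literature.NumberTheory.LFunctions.truncatedExplicitFormula_psiChar`). It packages Bombieri's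
log-free zero-density estimate with the Deuring–Heilbronn factor, in the form in which the proof
of Linnik's theorem consumes it.

## What the sources print

* Granville–Mollin, *Rabinowitsch revisited*, Acta Arith. 96 (2000), p. 145–146: "By the proof of
  Linnik's Theorem in [4] on pages 54–55, we find that for fixed `C > 9`, there exists a small
  constant `c > 0` such that if `x ≥ T^C` then
  (3.2) `∑_{|d| ≤ T} ∑_{|γ| < T} x^{Re ϱ} ≪ x^{1/2} T³ + δ x^{1 − c/log T}`,
  where `δ = (1 − β) log T` if there is a Siegel zero, and `δ = 1` otherwise. Here we sum over the
  zeros of `L(s, (d/·))`, with `d` squarefree, and of `ζ(s)` when `d = 1`. Note that we have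
  improved "`T⁵`" to "`T³`" in (3.2) from what appears in [4], though this follows easily from the
  proof there by noting that `L(s, (d/·))` with `|d| ≤ T` has `≪ T²` zeros with `|γ| < T`." The
  inner sum is, as in (3.1) just before ("the sum is over all other zeros `ϱ = σ + iγ` of this
  `L`-function"), over the zeros other than the Siegel zero; p. 142 fixes the meaning of "Siegel
  zero": "`L(σ + it, χ) ≠ 0` for `σ ≥ 1 − c/log(q(|t| + 2))` (for some explicit `c > 0`), except
  possibly when `χ` is real and `t = 0`. These are the "Siegel zeros" … we shall denote this zero
  by `β` if it exists". [cite: GranvilleMollin2000, §3 (3.2) and p. 142]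
* Bombieri, *Le grand crible dans la théorie analytique des nombres*, Astérisque 18 (2ᵉ éd. 1987),
  §6: the *Lemme de Landau–Page* (p. 39: `L(s, χ) ≠ 0` for `σ ≥ 1 − c₁/log T`, `|t| ≤ T`, all
  primitive `χ` of modulus `q ≤ T`, with at most one — real, simple — exception `β₁ = 1 − δ₁`,
  "le zéro exceptionnel relatif à `T, c₁`"); **Théorème 14** (p. 40): with `N(α, T; χ)` the number
  of zeros of `L(s, χ)` in `α ≤ σ ≤ 1`, `|t| ≤ T`, the exceptional zero excluded,
  `∑_{q ≤ T} ∑*_{χ mod q} N(α, T; χ) ≪ T^{c₂(1−α)}`, and if moreover there is an exceptional zero,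
  `∑_{q ≤ T} ∑*_{χ mod q} N(α, T; χ) ≪ (δ₁ log T) T^{c₂(1−α)}`, "les constantes implicites dans `≪`
  et `c₂` sont absolues et effectivement calculables"; Remarque: "la première partie du
  Théorème 14 est valable avec `c₂ = 8 + ε`"; and the *Preuve du Théorème de Linnik*, pp. 54–55:
  `∑_{q ≤ T} ∑_{χ} ∑'_{|γ| ≤ T} x^{Re ρ} ≪ x^{1/2} T⁵ + (δ₁ log T) x^{1 − c₁/log T}` "si
  `x > T^{c₂}`" ("on remplace `δ₁ log T` par `1` s'il n'y a pas de zéro exceptionnel"), used with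
  "`x = T^A`, où `A ≥ c₂ + 1`" — the origin of Granville–Mollin's "`C > 9`".
  [cite: Bombieri1987GrandCrible, §6 Théorème 14 and pp. 54–55]

## The named fact, and what is (deliberately) weaker than the print

`GranvilleMollin2000_eq32` renders (3.2) for ONE character of the family: the primitive quadratic
character `χ` modulo `q ≤ T` (the Kronecker symbol of the fundamental discriminant `±q`, one of
the `L(s, (d/·))`, `|d| ≤ q ≤ T`, of the double sum). Since every term `x^{Re ϱ}` is positive, the
single inner sum is bounded by the double sum, so this is implied by the printed estimate. The two
printed cases become two clauses, "Siegel zero" being a real zero `β > 1 − c₁/log(2q)` for a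
threshold constant `c₁ > 0` supplied by the fact (p. 142): (i) if `L(s, χ)` has no such zero, the
sum over all its non-trivial zeros with `|γ| ≤ T` is `≤ K(x^{1/2}T³ + x^{1−c/log T})`; (ii) if
`β₁` is such a zero, the sum over the OTHER zeros is
`≤ K(x^{1/2}T³ + (1 − β₁)(log T) x^{1−c/log T})`. Zeros are counted with multiplicity
(`Literature.NumberTheory.LFunctions.DirichletDisc.zeroOrder`), over the box `0 < Re ρ < 1`,
`|Im ρ| ≤ T` (`Literature.NumberTheory.LFunctions.lfunctionZeroBox`; the closed condition
`|γ| ≤ T` in place of `|γ| < T` only weakens the claim, the bound being monotone in `T`). A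
threshold `T ≥ T₀` is added and all constants may depend on `C` (both weakenings).

Discharging the fact requires the log-free zero-density theorem for the family of real primitive
characters of conductor `≤ T` up to height `T` with the Deuring–Heilbronn factor `δ₁ log T` and
density exponent `< C − 1` for every `C > 9` (Bombieri's Théorème 14 with `c₂ = 8 + ε`; Jutila
1977 and Graham 1981 give smaller exponents), together with the Landau–Page lemma; none of this is
in Mathlib.

## References

* A. Granville, R. A. Mollin, *Rabinowitsch revisited*, Acta Arith. 96 (2000), 139–153, §3
  (3.1)–(3.2), p. 142 (`GranvilleMollin2000`).
* E. Bombieri, *Le grand crible dans la théorie analytique des nombres*, Astérisque 18, 2ᵉ éd.,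
  SMF 1987, §6: Lemme de Landau–Page (p. 39), Théorème 14 (p. 40), Théorème 16 (p. 41), Preuve du
  Théorème de Linnik (pp. 54–55) (`Bombieri1987GrandCrible`).
-/

noncomputable section

open Complex Finset

namespace Literature.NumberTheory.LFunctions

/-! ## The sum `∑ m(ρ) x^{Re ρ}` over a box of zeros -/

section PowerSum

variable {q : ℕ} [NeZero q] (χ : DirichletCharacter ℂ q)

/-- `∑_{ρ, |γ| ≤ T, ρ ∉ E} m(ρ) x^{Re ρ}`: the sum of `x^{Re ρ}` over the non-trivial zeros
`ρ = β + iγ` of `L(s, χ)` with `0 < β < 1`, `|γ| ≤ T` and `ρ` outside the finite exclusion set `E`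
(the Siegel zero, when it is to be omitted), each zero repeated according to its multiplicity
`m(ρ) = Literature.NumberTheory.LFunctions.DirichletDisc.zeroOrder χ ρ`; a `Finset` sum over `lfunctionZeroBox χ T` when this set is
finite (always, for `χ ≠ χ₀`), and `0` otherwise. This is the inner sum of Granville–Mollin's
(3.2). [cite: GranvilleMollin2000, §3 (3.2)] -/
def charZeroPowerSum (x T : ℝ) (E : Finset ℂ) : ℝ := by
  classical
  exact if h : (lfunctionZeroBox χ T).Finite then
    ∑ ρ ∈ h.toFinset \ E, (DirichletDisc.zeroOrder χ ρ : ℝ) * x ^ ρ.re else 0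

variable {χ}

/-- For `χ ≠ χ₀`, `charZeroPowerSum` is the `Finset` sum over the finite box of zeros minus the
exclusion set. [folklore] -/
theorem charZeroPowerSum_eq (hχ : χ ≠ 1) (x T : ℝ) (E : Finset ℂ) :
    charZeroPowerSum χ x T E =
      ∑ ρ ∈ (lfunctionZeroBox_finite hχ T).toFinset \ E,
        (DirichletDisc.zeroOrder χ ρ : ℝ) * x ^ ρ.re := by
  classical
  rw [charZeroPowerSum, dif_pos (lfunctionZeroBox_finite hχ T)]

/-- Every term of `charZeroPowerSum` is non-negative, so the sum is `≥ 0` (for `x ≥ 0`).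
[folklore] -/
theorem charZeroPowerSum_nonneg {x : ℝ} (hx : 0 ≤ x) (T : ℝ) (E : Finset ℂ) :
    0 ≤ charZeroPowerSum χ x T E := by
  classical
  rw [charZeroPowerSum]
  split_ifs with h
  · exact sum_nonneg fun ρ _ ↦ mul_nonneg (Nat.cast_nonneg _) (Real.rpow_nonneg hx _)
  · exact le_rfl

/-- Shrinking the exclusion set can only increase the sum (for `x ≥ 0`). [folklore] -/
theorem charZeroPowerSum_mono {x : ℝ} (hx : 0 ≤ x) (T : ℝ) {E E' : Finset ℂ} (h : E ⊆ E') :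
    charZeroPowerSum χ x T E' ≤ charZeroPowerSum χ x T E := by
  classical
  rw [charZeroPowerSum, charZeroPowerSum]
  split_ifs with hfin
  · exact sum_le_sum_of_subset_of_nonneg (sdiff_subset_sdiff Subset.rfl h)
      fun ρ _ _ ↦ mul_nonneg (Nat.cast_nonneg _) (Real.rpow_nonneg hx _)
  · exact le_rfl

end PowerSum

/-! ## The named fact -/

/-- **Granville–Mollin 2000, (3.2)** NAMED FACT (Bombieri's log-free zero-density estimate with
the Deuring–Heilbronn factor, as consumed by the proof of Linnik's theorem; Bombieri, *Le grand
crible*, Théorème 14 and pp. 54–55), for one character of the printed family: "for fixed `C > 9`,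
there exists a small constant `c > 0` such that if `x ≥ T^C` then
`∑_{|d| ≤ T} ∑_{|γ| < T} x^{Re ϱ} ≪ x^{1/2} T³ + δ x^{1 − c/log T}`, where `δ = (1 − β) log T` if
there is a Siegel zero, and `δ = 1` otherwise", the inner sum over the zeros of `L(s, (d/·))`
other than the Siegel zero `β` (a real zero `β > 1 − c₁/log(2q)`, p. 142). Rendered for the
primitive quadratic character `χ` mod `q ≤ T` (one `d` of the sum; all terms are positive): for
every `C > 9` there are `c > 0`, `c₁ > 0`, `K`, `T₀` such that for all `q`, all primitive
quadratic `χ ≠ χ₀` mod `q`, all `T ≥ T₀` with `q ≤ T` and all `x ≥ T^C`: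
(i) if `L(s, χ)` has no real zero `β > 1 − c₁/log(2q)` then
`∑_{ρ, |γ| ≤ T} m(ρ) x^{Re ρ} ≤ K (x^{1/2} T³ + x^{1 − c/log T})`;
(ii) if `β₁ > 1 − c₁/log(2q)` is a real zero of `L(s, χ)` then
`∑_{ρ ≠ β₁, |γ| ≤ T} m(ρ) x^{Re ρ} ≤ K (x^{1/2} T³ + (1 − β₁)(log T) x^{1 − c/log T})`
(`charZeroPowerSum` over `lfunctionZeroBox`, multiplicities `Literature.NumberTheory.LFunctions.DirichletDisc.zeroOrder`).
Users take `(h : GranvilleMollin2000_eq32)`.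
[cite: GranvilleMollin2000, §3 (3.2)] [cite: Bombieri1987GrandCrible, §6 Théorème 14 and pp. 54–55] -/
def GranvilleMollin2000_eq32 : Prop :=
  ∀ C : ℝ, 9 < C → ∃ c : ℝ, 0 < c ∧ ∃ c₁ : ℝ, 0 < c₁ ∧ ∃ K T₀ : ℝ,
    ∀ (q : ℕ) [NeZero q] (χ : DirichletCharacter ℂ q), χ ≠ 1 → χ.IsPrimitive → χ.IsQuadratic →
      ∀ T : ℝ, T₀ ≤ T → (q : ℝ) ≤ T → ∀ x : ℝ, T ^ C ≤ x →
        ((∀ β : ℝ, 1 - c₁ / Real.log (2 * q) < β → χ.LFunction β ≠ 0) →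
            charZeroPowerSum χ x T ∅ ≤
              K * (x ^ (1 / 2 : ℝ) * T ^ (3 : ℝ) + x ^ (1 - c / Real.log T))) ∧
        (∀ β₁ : ℝ, 1 - c₁ / Real.log (2 * q) < β₁ → χ.LFunction β₁ = 0 →
            charZeroPowerSum χ x T {(β₁ : ℂ)} ≤
              K * (x ^ (1 / 2 : ℝ) * T ^ (3 : ℝ) +
                (1 - β₁) * Real.log T * x ^ (1 - c / Real.log T)))

end Literature.NumberTheory.LFunctions

end
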